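import Summits.BirchSwinnertonDyer.BirchSwinnertonDyer.Theorems.PrintCf2RamifiedOffTYZSquareSilenceCoefficients
import HarnessLib

/-!
# Crux `PrintCf2.RamifiedOffTYZOfFacts` (stmt-BirchSwinnertonDyer-20509), line `offtyz-v7`, LEAD cycle 14 (cruxlead-20509 g13):
# SQUARE SILENCE ON THE STABILISER, even `n` — the top block silenced PER STABILISER ELEMENT, the odd blocks only where the recursion reaches them

THEOREMS ONLY (no `def`, no named fact, no `sorry`), `--supports stmt-BirchSwinnertonDyer-20509` (C⁺ = item 23431, even sector).  Refinement of g12's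
`SquareSilenceCoefficients.galPt_sq_genusPoint_eq_of_coefficients_even` (p735302) in two places, both forced by the `k = 3` residual types of the
even jump-one class (crux workfile `Lines/offtyz_v7_RegimeFreeLaw.md`):
* the TOP block `D = n` is no longer silenced by a global witness (there is none in the genus regime — type `(3,3,3)`, `g(n)` odd, `χ_n ≢ 0`) but by
  the hypothesis «`χ_n(g) = 0` for THIS `g`» on the stabiliser of `i, √−2, √−n` (supplied by the regime-free block law / the Frobenius row span);
* the ODD blocks `≡ 5 (mod 8)` are required to be prime-or-witnessed only where g8's square formula actually reaches them (second and third level of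
  the recursion: `d′ ∈ R(d)`, `d ∈ R(n)`, and `e ∈ R(d′)`, `d′ ∈ R(d)`, `d ∈ R(n)` even) — type `(3,7,7)` has composite blocks `ab, ac ≡ 5` with no
  witness, which the recursion never reaches.
§1 `galPt_sq_genusPoint_eq_of_stabiliser_even`; §2 the lower half `two_dvd_scriptL_of_stabiliser_even_of_x_not_mem` (g11's even door on the even
half-mover, as in p735302 §3).  BSD is not proved by any of this; no class is closed by this file.

References: [cite: TianYuanZhang2017, §3.1 (p0011 L1–L13, L53–L73), Prop. 3.2 (1)(2), Thm. 3.5, Thm. 3.6 (1)(2), Lemma 3.18, proof of Lemma 3.21 (p0020 L27–L63)];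
[cite: Darmon2004, Thm. 3.22]; tree: p735302, p733231, p729925, p703022.
-/

noncomputable section

open scoped Classical

open WeierstrassCurve WeierstrassCurve.Affine Finset Literature.NumberTheory.EllipticCurves
  Literature.NumberTheory.EllipticCurves.TianYuanZhang2017
  Literature.NumberTheory.EllipticCurves.TianYuanZhang2017.W2
  Summit.BirchSwinnertonDyer.Rank1Residual.P2.GenusPeriodTransferLayer
  Summit.BirchSwinnertonDyer.Rank1Residual.P2.ThetaDescent
  Summit.BirchSwinnertonDyer.Rank1Residual.P2
  Summit.BirchSwinnertonDyer.PrintCf2.MoverAssembly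
  Summit.BirchSwinnertonDyer.PrintCf2.SquareSilenceEven
  Summit.BirchSwinnertonDyer.PrintCf2.SquareSilenceWitnesses
  Summit.BirchSwinnertonDyer.PrintCf2.LowerHalfDoor
  Summit.BirchSwinnertonDyer.PrintCf2.LowerHalfDoorEven
  Summit.BirchSwinnertonDyer.PrintCf2.LowerHalfTwoPrimesEven

set_option autoImplicit false

namespace Summit.BirchSwinnertonDyer.PrintCf2.SquareSilenceStabiliser

variable {n : ℕ} (D : GenusPointData n)

/-! ## §1 Silence on the stabiliser with a per-element top hypothesis and reachable odd blocks -/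

/-- **SQUARE SILENCE ON `Stab(i, √−2)`, even `n ≡ 6 (mod 8)`, refined.**  `n` square-free; the displayed recursion and CM-point layer; `g` fixing `i`
and `√−2`.  Hypotheses: (top) IF `g` fixes `√−n` then `(g·g)^{g(n)}σ_n⁻¹ ∉ Gal(ℍ′_n/H′_n)` (the top character vanishes AT `g`); (proper even blocks
`D ≡ 6`) `D = 2p`, OR a witness, OR `𝓛(n/D)` even; (odd blocks `≡ 5`, ONLY those reached by the recursion: `d′ ∈ R(d)` for `d ∈ R(n)`, and
`e ∈ R(d′)`, `d′ ∈ R(d)`, `d ∈ R(n)` even) prime OR a witness.  Then `g·g·P(n) = P(n)`.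
[cite: TianYuanZhang2017, §3.1 (p0011 L1–L13, L53–L73), Prop. 3.2 (1)(2), Thm. 3.6 (1)(2), proof of Lemma 3.21 (p0020 L27–L63)] -/
theorem galPt_sq_genusPoint_eq_of_stabiliser_even (hsq : Squarefree n) (h6 : n % 8 = 6) (hrec : D.recursion)
    (z : ℕ → APoint D.H) (Φ : ℕ → Finset (D.H ≃ₐ[ℚ] D.H)) (ΓH ΓH' : ℕ → Subgroup (D.H ≃ₐ[ℚ] D.H))
    (σ : ℕ → (D.H ≃ₐ[ℚ] D.H)) (c : D.H ≃ₐ[ℚ] D.H) (hc : D.ConjSpec c)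
    (hblock : ∀ d ∈ n.divisors, ((d % 8 = 5 ∨ d % 8 = 6) → D.CMBlockSpec d (z d) (Φ d) (ΓH d) (ΓH' d) (σ d) c) ∧
      (d % 8 = 7 → D.SevenBlockSpec d))
    (g : D.H ≃ₐ[ℚ] D.H) (hgi : g D.im = D.im) (hg2 : g (D.sqrtNeg 2) = D.sqrtNeg 2)
    (htop : g (D.sqrtNeg n) = D.sqrtNeg n → (g * g) ^ gK n * (σ n)⁻¹ ∉ ΓH' n)
    (heven : ∀ d ∈ n.divisors, d % 8 = 6 → d ≠ n →
      (∃ p : ℕ, p.Prime ∧ d = 2 * p) ∨ (∃ e : D.H ≃ₐ[ℚ] D.H, D.TrivialOnL d e ∧ e * e ∈ ΓH' d ∧ e ∉ ΓH d) ∨ Even (D.scriptL (n / d)))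
    (hodd₂ : ∀ d ∈ recursionIndex n, ∀ d' ∈ recursionIndex d, d' % 8 = 5 →
      d'.Prime ∨ (∃ e : D.H ≃ₐ[ℚ] D.H, D.TrivialOnL d' e ∧ e * e ∈ ΓH' d' ∧ e ∉ ΓH d'))
    (hodd₃ : ∀ d ∈ recursionIndex n, d % 2 = 0 → ∀ d' ∈ recursionIndex d, ∀ e ∈ recursionIndex d', e % 8 = 5 →
      e.Prime ∨ (∃ e' : D.H ≃ₐ[ℚ] D.H, D.TrivialOnL e e' ∧ e' * e' ∈ ΓH' e ∧ e' ∉ ΓH e)) :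
    D.galPt (g * g) (D.P n) = D.P n := by
  have hn0 : n ≠ 0 := hsq.ne_zero
  have hnn : n ∈ n.divisors := Nat.mem_divisors_self n hn0
  have hdvd_of_rec : ∀ {d d' : ℕ}, d' ∈ recursionIndex d → d' ∣ d := fun hd' =>
    Nat.dvd_of_mem_divisors (Finset.mem_filter.mp hd').1
  have hmem : ∀ {d : ℕ}, d ∣ n → d ∈ n.divisors := fun hd => Nat.mem_divisors.mpr ⟨hd, hn0⟩
  -- an odd block `≡ 5` that is prime or witnessed has vanishing indicator
  have hι5 : ∀ d ∈ n.divisors, d % 8 = 5 →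
      (d.Prime ∨ (∃ e : D.H ≃ₐ[ℚ] D.H, D.TrivialOnL d e ∧ e * e ∈ ΓH' d ∧ e ∉ ΓH d)) →
      ¬ (g (D.sqrtNeg d) = D.sqrtNeg d ∧ (g * g) ^ gK d * (σ d)⁻¹ ∈ ΓH' d) := by
    rintro d hd h5 hpw ⟨hfix, hχ⟩
    have hd1 : 1 < d := by omega
    rcases hpw with hp | ⟨e, heL, hee, heH⟩
    · exact chi_eq_zero_of_trivialOnL_of_cmBlockSpec D hd1 ((hblock d hd).1 (Or.inl h5)) (trivialOnL_prime_of_fix D hp hgi hfix) hχ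
    · exact not_sqChi_of_trivialOnL_involution D hd hd1 ((hblock d hd).1 (Or.inl h5)) heL hee heH g hχ
  -- the top block: at `g`
  have hιn : ¬ ((n % 8 = 5 ∨ n % 8 = 6) ∧ g (D.sqrtNeg n) = D.sqrtNeg n ∧ (g * g) ^ gK n * (σ n)⁻¹ ∈ ΓH' n) := by
    rintro ⟨-, hfix, hχ⟩
    exact htop hfix hχ
  rw [galPt_mul_self_P_eq_add_even D hsq h6 hrec z Φ ΓH ΓH' σ c hc hblock g, if_neg hιn]
  -- chains through blocks `≡ 5` (second level)
  have hS2 : ∑ d ∈ recursionIndex n, ∑ d' ∈ (recursionIndex d).filter (fun d' => d' % 8 = 5),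
      (D.scriptL (n / d)).natAbs * (D.scriptL (d / d')).natAbs *
        (if (d' % 8 = 5 ∨ d' % 8 = 6) ∧ g (D.sqrtNeg d') = D.sqrtNeg d' ∧ (g * g) ^ gK d' * (σ d')⁻¹ ∈ ΓH' d' then 1 else 0) = 0 := by
    refine Finset.sum_eq_zero fun d hd => Finset.sum_eq_zero fun d' hd' => ?_
    obtain ⟨hd'r, hd'5⟩ := Finset.mem_filter.mp hd'
    rw [if_neg (fun hh => hι5 d' (hmem ((hdvd_of_rec hd'r).trans (hdvd_of_rec hd))) hd'5 (hodd₂ d hd d' hd'r hd'5) hh.2), mul_zero]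
  -- third level (through even blocks)
  have hS3 : ∑ d ∈ (recursionIndex n).filter (fun d => d % 2 = 0), ∑ d' ∈ recursionIndex d,
      ∑ e ∈ (recursionIndex d').filter (fun e => e % 8 = 5),
        (D.scriptL (n / d)).natAbs * (D.scriptL (d / d')).natAbs * (D.scriptL (d' / e)).natAbs *
          (if (e % 8 = 5 ∨ e % 8 = 6) ∧ g (D.sqrtNeg e) = D.sqrtNeg e ∧ (g * g) ^ gK e * (σ e)⁻¹ ∈ ΓH' e then 1 else 0) = 0 := by
    refine Finset.sum_eq_zero fun d hd => Finset.sum_eq_zero fun d' hd' => Finset.sum_eq_zero fun e he => ?_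
    obtain ⟨hdr, hd2⟩ := Finset.mem_filter.mp hd
    obtain ⟨her, he5⟩ := Finset.mem_filter.mp he
    rw [if_neg (fun hh => hι5 e (hmem (((hdvd_of_rec her).trans (hdvd_of_rec hd')).trans (hdvd_of_rec hdr))) he5
      (hodd₃ d hdr hd2 d' hd' e her he5) hh.2), mul_zero]
  -- single chains: even by block
  have hS1 : Even (∑ d ∈ recursionIndex n, (D.scriptL (n / d)).natAbs *
      (if (d % 8 = 5 ∨ d % 8 = 6) ∧ g (D.sqrtNeg d) = D.sqrtNeg d ∧ (g * g) ^ gK d * (σ d)⁻¹ ∈ ΓH' d then 1 else 0)) := by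
    refine Finset.even_sum _ fun d hd => ?_
    have hdn : d ∈ n.divisors := hmem (hdvd_of_rec hd)
    by_cases hh : (d % 8 = 5 ∨ d % 8 = 6) ∧ g (D.sqrtNeg d) = D.sqrtNeg d ∧ (g * g) ^ gK d * (σ d)⁻¹ ∈ ΓH' d
    · obtain ⟨h56, hfix, hχ⟩ := hh
      rcases h56 with h5 | h6'
      · -- `d ≡ 5 (mod 8)` is never in `R(n)` for `n ≡ 6 (mod 8)`: `n/d` would be `≡ 6 (mod 8)`
        exfalso
        obtain ⟨-, -, h123, -⟩ := mem_recursionIndex_iff.mp hd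
        have hdvd : d ∣ n := hdvd_of_rec hd
        obtain ⟨q, hq⟩ := hdvd
        have hq' : n / d = q := by rw [hq, Nat.mul_div_cancel_left q (by omega)]
        rw [hq'] at h123
        have : (d * q) % 8 = 6 := by rw [← hq]; exact h6
        have h8 : (d % 8) * (q % 8) % 8 = 6 := by rw [← Nat.mul_mod, this]
        rw [h5] at h8
        rcases h123 with h1 | h2 | h3 <;> rw [‹q % 8 = _›] at h8 <;> omega
      · have hd1 : 1 < d := by omega
        have hgt : 1 < n / d := (Finset.mem_filter.mp hd).2.2.2
        have hdne : d ≠ n := by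
          rintro rfl; rw [Nat.div_self (Nat.pos_of_ne_zero hn0)] at hgt; exact lt_irrefl 1 hgt
        rcases heven d hdn h6' hdne with ⟨p, hp, rfl⟩ | ⟨e, heL, hee, heH⟩ | hev
        · have hp2 : p ≠ 2 := by rintro rfl; omega
          exact absurd hχ (chi_eq_zero_of_trivialOnL_of_cmBlockSpec D hd1 ((hblock _ hdn).1 (Or.inr h6'))
            (trivialOnL_two_mul_prime_of_fix D hsq hp hp2 hdn hgi hg2 hfix))
        · exact absurd hχ (not_sqChi_of_trivialOnL_involution D hdn hd1 ((hblock d hdn).1 (Or.inr h6')) heL hee heH g)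
        · rw [if_pos ⟨Or.inr h6', hfix, hχ⟩, mul_one]
          exact Int.natAbs_even.mpr hev
    · rw [if_neg hh, mul_zero]; exact ⟨0, rfl⟩
  obtain ⟨r, hr⟩ := hS1
  rw [hS2, hS3, add_zero, add_zero, zero_add, hr, show r + r = 2 * r by ring, nsmul_tauOne_eq_mod_two,
    Nat.mul_mod_right, zero_smul, add_zero]

/-! ## §2 The lower half from the stabiliser silence (even `n`): door + even half-mover -/

/-- **LOWER HALF from the refined stabiliser silence, even `n ≡ 6 (mod 8)`**: analytic rank one, GZK, Thm 3.5 main clause, sign choices, Lemma 3.18;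
the hypotheses of `galPt_sq_genusPoint_eq_of_stabiliser_even` for EVERY element of `Stab(i, √−2, √−n)` (top character vanishing there, proper even blocks
`2p`/witness/even cofactor, reachable odd blocks prime/witness); a generator `R = (x, y)` of `E_n(ℚ)` modulo torsion with `x ∉ {±1, ±2, ±n, ±2n}·ℚ^{×2}`.
Then `2 ∣ L` whenever `𝓛(n)² = L²`.
[cite: TianYuanZhang2017, Thm. 3.5 (p0011 L94–L100), Lemma 3.18, §3.1, Prop. 3.2, Thm. 3.6, proof of Lemma 3.21, §1 (p0002 L101–L110)] [cite: Darmon2004, Thm. 3.22] -/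
theorem two_dvd_scriptL_of_stabiliser_even_of_x_not_mem
    (hGZK : rank_eq_analyticRank_of_analyticRank_le_one) (hsq : Squarefree n) (h6 : n % 8 = 6)
    (hr : haveI := isElliptic_congruentNumberCurve hsq.ne_zero; (congruentNumberCurve n).analyticRank = 1)
    (hrec : D.recursion) (h35 : D.thm35Main) (hLs : D.scriptLSpec) (h318 : D.lemma318)
    (z : ℕ → APoint D.H) (Φ : ℕ → Finset (D.H ≃ₐ[ℚ] D.H)) (ΓH ΓH' : ℕ → Subgroup (D.H ≃ₐ[ℚ] D.H))
    (σ : ℕ → (D.H ≃ₐ[ℚ] D.H)) (c : D.H ≃ₐ[ℚ] D.H) (hc : D.ConjSpec c)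
    (hblock : ∀ d ∈ n.divisors, ((d % 8 = 5 ∨ d % 8 = 6) → D.CMBlockSpec d (z d) (Φ d) (ΓH d) (ΓH' d) (σ d) c) ∧
      (d % 8 = 7 → D.SevenBlockSpec d))
    (htop : ∀ g : D.H ≃ₐ[ℚ] D.H, g D.im = D.im → g (D.sqrtNeg 2) = D.sqrtNeg 2 → g (D.sqrtNeg n) = D.sqrtNeg n →
      (g * g) ^ gK n * (σ n)⁻¹ ∉ ΓH' n)
    (heven : ∀ d ∈ n.divisors, d % 8 = 6 → d ≠ n →
      (∃ p : ℕ, p.Prime ∧ d = 2 * p) ∨ (∃ e : D.H ≃ₐ[ℚ] D.H, D.TrivialOnL d e ∧ e * e ∈ ΓH' d ∧ e ∉ ΓH d) ∨ Even (D.scriptL (n / d)))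
    (hodd₂ : ∀ d ∈ recursionIndex n, ∀ d' ∈ recursionIndex d, d' % 8 = 5 →
      d'.Prime ∨ (∃ e : D.H ≃ₐ[ℚ] D.H, D.TrivialOnL d' e ∧ e * e ∈ ΓH' d' ∧ e ∉ ΓH d'))
    (hodd₃ : ∀ d ∈ recursionIndex n, d % 2 = 0 → ∀ d' ∈ recursionIndex d, ∀ e ∈ recursionIndex d', e % 8 = 5 →
      e.Prime ∨ (∃ e' : D.H ≃ₐ[ℚ] D.H, D.TrivialOnL e e' ∧ e' * e' ∈ ΓH' e ∧ e' ∉ ΓH e))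
    {x y : ℚ} (hxy : (congruentNumberCurve n).toAffine.Nonsingular x y)
    (hgen : haveI := isElliptic_congruentNumberCurve hsq.ne_zero;
      ∀ P, ∃ k : ℤ, IsOfFinAddOrder (P - k • (Point.some x y hxy : (congruentNumberCurve n).toAffine.Point)))
    (hx : ¬ ∃ r : ℚ, x = r ^ 2 ∨ x = -r ^ 2 ∨ x = n * r ^ 2 ∨ x = -(n * r ^ 2))
    (hx2 : ¬ ∃ r : ℚ, x = 2 * r ^ 2 ∨ x = -(2 * r ^ 2) ∨ x = 2 * n * r ^ 2 ∨ x = -(2 * n * r ^ 2)) :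
    ∀ L : ℤ, IsScriptL n L → (2 : ℤ) ∣ L := by
  haveI := isElliptic_congruentNumberCurve hsq.ne_zero
  have hnn : n ∈ n.divisors := Nat.mem_divisors_self n hsq.ne_zero
  obtain ⟨Q₁, hQ₁⟩ := twist_halving hsq hnn D (Point.some x y hxy)
  obtain ⟨g₀, hgi, hg2, hgK, hmoveQ⟩ :=
    LowerHalfTwoPrimesEven.exists_halfMover_even_of_x_not_mem hsq (Nat.dvd_of_mod_eq_zero (by omega)) D hxy hx hx2 hQ₁
  have hsq0 := galPt_sq_genusPoint_eq_of_stabiliser_even D hsq h6 hrec z Φ ΓH ΓH' σ c hc hblock g₀ hgi hg2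
    (fun hK => htop g₀ hgi hg2 hK) heven hodd₂ hodd₃
  exact two_dvd_scriptL_of_halfMover_of_sq_eq_even hGZK hsq h6 hr D h35 hLs h318 hgen hQ₁ g₀ hgi hg2 hgK hmoveQ hsq0

end Summit.BirchSwinnertonDyer.PrintCf2.SquareSilenceStabiliser

end
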